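import Literature.Analysis.PDE.TorusQuasilinearLimit
import Literature.Analysis.PDE.CoefficientCutoff
import Mathlib.Analysis.CStarAlgebra.Matrix
import Mathlib.LinearAlgebra.Matrix.PosDef
import HarnessLib

/-!
# Local classical solutions of quasilinear symmetric hyperbolic systems on `𝕋³` (and on `𝕋ᵈ`
# for every `d`) with matrix coefficients on an open state domain (topic `Analysis/PDE`)

Analysis/PDE support file (everything proved; no definitions, no named facts): the matrix form
of the local existence theorem for quasilinear symmetric hyperbolic systems
`A₀(V)∂ₜV + Σₖ Aₖ(V)∂ₖV = 0` on the flat torus `𝕋³` (Dafermos 2005, Thm 5.1.1; Majda 1984,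
Ch. 2, Thm 2.1 with p. 31 (localisation to `G₁ ⊂⊂ G`); Kato 1975), as consumed by
`Literature.MathematicalPhysics.KineticTheory.hsEuler_localExistence_of_symmHyperbolicLocalExistence`,
in the case of a DIAGONAL `A₀` (the hard-sphere Euler system in the variables `(ρ, v, θ)` has
`A⁰ = diag(p_ρ/ρ, ρ, ρ, ρ, 3ρ/(2θ))`, `hsSymA0_eq_diagonal`), where the smooth congruence
`Q A₀ P = 1` required by `IsQLSymmCoeff` is the explicit `P = Q = diag(aᵢᵢ^{-1/2})`:

* `contDiffOn_toEuclideanCLM`, `inner_toEuclideanCLM_symm`, `inner_toEuclideanCLM_pos` —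
  the dictionary `Matrix (Fin N) (Fin N) ℝ → End(ℝᴺ)` (through `Matrix.toEuclideanCLM`);
* `exists_isQLSymmCoeff_cutoff` — cutting the coefficients off outside a compact part of the
  state domain (`CoefficientCutoff`) and symmetrising by `diag(ãᵢᵢ^{-1/2})` produces admissible
  data `IsQLSymmCoeff c₀ Λ₀ ã₀ ã P P` agreeing with `A₀, Aₖ` where the cut-off is `1`;
* `symmHyperbolicLocalExistence_of_diagonal` — **the local existence theorem in matrix form**:
  for `𝒪 ⊆ ℝᴺ` open, `A₀, Aₖ` smooth on `𝒪`, `A₀` positive definite and diagonal, `Aₖ`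
  symmetric, and smooth data with compact range in `𝒪`, there are `T > 0` and a jointly smooth
  `V` on `[0, T) × 𝕋³` with values in `𝒪`, `V(0) = V₀`, solving the system classically
  (`IsQLSymmCoeff.exists_smooth_solution` for the cut-off data, then a tube argument keeps the
  values in the region where the cut-off is `1`).

Generic dimension: the same two statements are proved first for any index type `ι` of directions
(`exists_isQLSymmCoeff_cutoff_gen` — the cut-off acts on the state space only) and on `𝕋ᵈ` for
EVERY `d` (`symmHyperbolicLocalExistence_of_diagonal_dim (d N : ℕ) …`, through Majda's theorem on
`𝕋ᵈ` in the `C^∞` class `IsQLSymmCoeff.exists_smooth_solution_of_wordSup` at the Sobolev margin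
`σ = d + 1`, hypothesis-free by the word-form sup embedding `Torus.wordSupEmbedding_fin`; Majda
1984, Thm 2.1 in any number of space variables; Kato 1975, Thm II); the `𝕋³` statements above are
their `ι = Fin 3` / `d = 3` instances, with unchanged statements.

## Mathlib / tree search

Tree: `TorusQuasilinearLimit` (`IsQLSymmCoeff.exists_smooth_solution`,
`IsQLSymmCoeff.exists_smooth_solution_of_wordSup`), `Torus.wordSupEmbedding_fin`
(`FunctionSpaces/TorusWordSupEmbedding`), `CoefficientCutoff`,
`TorusQuasilinearAPriori` (`IsQLSymmCoeff`). Mathlib: `Matrix.toEuclideanCLM`,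
`Matrix.PosDef`, `contDiffOn_clm_apply`, `contDiffOn_euclidean`, `generalized_tube_lemma`.

## References

* C. M. Dafermos, *Hyperbolic Conservation Laws in Continuum Physics*, 2nd ed., Springer 2005,
  §5.1, Thm 5.1.1. [`Dafermos2005`]
* A. Majda, *Compressible Fluid Flow and Systems of Conservation Laws in Several Space
  Variables*, Springer 1984, Ch. 2 §2.1, Thm 2.1 and p. 31. [`Majda1984`]
* T. Kato, Arch. Rational Mech. Anal. 58 (1975) 181–205, Thm II. [`Kato1975`]
-/

noncomputable section

open Set Filter Function Matrix
open scoped ContDiff Topology InnerProductSpace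

namespace Literature.Analysis.PDE

open Literature.Analysis.FunctionSpaces Literature.Analysis.FunctionSpaces.Torus

variable {N : ℕ}

/-! ## The dictionary `Matrix → End(ℝᴺ)` -/

/-- Coordinates of `Matrix.toEuclideanCLM (n := Fin N) (𝕜 := ℝ) M w`. [folklore] -/
theorem toEuclideanCLM_apply_coord (M : Matrix (Fin N) (Fin N) ℝ) (w : EuclideanSpace ℝ (Fin N)) (i : Fin N) :
    (Matrix.toEuclideanCLM (n := Fin N) (𝕜 := ℝ) M w) i = ∑ j, M i j * w j := by
  show (WithLp.ofLp (Matrix.toEuclideanCLM (n := Fin N) (𝕜 := ℝ) M w)) i = _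
  rw [ofLp_toEuclideanCLM]
  rfl

/-- **Smoothness of matrix fields as operator fields** from entrywise smoothness. [folklore] -/
theorem contDiffOn_toEuclideanCLM {E' : Type*} [NormedAddCommGroup E'] [NormedSpace ℝ E'] {O : Set E'}
    {M : E' → Matrix (Fin N) (Fin N) ℝ} (hM : ∀ i j, ContDiffOn ℝ ∞ (fun v => M v i j) O) :
    ContDiffOn ℝ ∞ (fun v => Matrix.toEuclideanCLM (n := Fin N) (𝕜 := ℝ) (M v)) O := by
  refine contDiffOn_clm_apply.2 fun w => contDiffOn_euclidean.2 fun i => ?_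
  have e : (fun v => (Matrix.toEuclideanCLM (n := Fin N) (𝕜 := ℝ) (M v) w) i) = fun v => ∑ j, M v i j * w j :=
    funext fun v => toEuclideanCLM_apply_coord (M v) w i
  rw [e]
  exact ContDiffOn.sum fun j _ => (hM i j).mul contDiffOn_const

/-- Smoothness on the whole space. [folklore] -/
theorem contDiff_toEuclideanCLM {E' : Type*} [NormedAddCommGroup E'] [NormedSpace ℝ E']
    {M : E' → Matrix (Fin N) (Fin N) ℝ} (hM : ∀ i j, ContDiff ℝ ∞ (fun v => M v i j)) :
    ContDiff ℝ ∞ (fun v => Matrix.toEuclideanCLM (n := Fin N) (𝕜 := ℝ) (M v)) := by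
  rw [← contDiffOn_univ]
  exact contDiffOn_toEuclideanCLM fun i j => (hM i j).contDiffOn

/-- `⟪Matrix.toEuclideanCLM (n := Fin N) (𝕜 := ℝ) M w, w'⟫ = (M w) · w'`. [folklore] -/
theorem inner_toEuclideanCLM_left_eq (M : Matrix (Fin N) (Fin N) ℝ) (w w' : EuclideanSpace ℝ (Fin N)) :
    ⟪Matrix.toEuclideanCLM (n := Fin N) (𝕜 := ℝ) M w, w'⟫_ℝ = (M *ᵥ WithLp.ofLp w) ⬝ᵥ WithLp.ofLp w' := by
  rw [real_inner_comm, inner_toEuclideanCLM, dotProduct_comm]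

/-- **Symmetric matrices give symmetric operators.** [folklore] -/
theorem inner_toEuclideanCLM_symm {M : Matrix (Fin N) (Fin N) ℝ} (hM : M.IsSymm) (w w' : EuclideanSpace ℝ (Fin N)) :
    ⟪Matrix.toEuclideanCLM (n := Fin N) (𝕜 := ℝ) M w, w'⟫_ℝ = ⟪w, Matrix.toEuclideanCLM (n := Fin N) (𝕜 := ℝ) M w'⟫_ℝ := by
  rw [inner_toEuclideanCLM_left_eq, inner_toEuclideanCLM, dotProduct_comm, dotProduct_mulVec, ← mulVec_transpose,
    hM.eq, dotProduct_comm]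

/-- **Positive definite matrices give positive operators.** [folklore] -/
theorem inner_toEuclideanCLM_pos {M : Matrix (Fin N) (Fin N) ℝ} (hM : M.PosDef) {w : EuclideanSpace ℝ (Fin N)} (hw : w ≠ 0) :
    0 < ⟪Matrix.toEuclideanCLM (n := Fin N) (𝕜 := ℝ) M w, w⟫_ℝ := by
  rw [real_inner_comm, inner_toEuclideanCLM]
  have hw' : WithLp.ofLp w ≠ 0 := fun h => hw (by simpa using congrArg (WithLp.toLp 2) h)
  simpa using hM.dotProduct_mulVec_pos hw'

/-- Diagonal entries as quadratic-form values: `⟪Matrix.toEuclideanCLM (n := Fin N) (𝕜 := ℝ) M eᵢ, eᵢ⟫ = Mᵢᵢ`. [folklore] -/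
theorem inner_toEuclideanCLM_single (M : Matrix (Fin N) (Fin N) ℝ) (i : Fin N) :
    ⟪Matrix.toEuclideanCLM (n := Fin N) (𝕜 := ℝ) M (EuclideanSpace.single i (1 : ℝ)), EuclideanSpace.single i (1 : ℝ)⟫_ℝ = M i i := by
  rw [inner_toEuclideanCLM_left_eq]
  simp [dotProduct]

/-- The operator of a diagonal matrix in coordinates. [folklore] -/
theorem toEuclideanCLM_diagonal_apply_coord (r : Fin N → ℝ) (w : EuclideanSpace ℝ (Fin N)) (i : Fin N) :
    (Matrix.toEuclideanCLM (n := Fin N) (𝕜 := ℝ) (Matrix.diagonal r) w) i = r i * w i := by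
  show (WithLp.ofLp (Matrix.toEuclideanCLM (n := Fin N) (𝕜 := ℝ) (Matrix.diagonal r) w)) i = _
  rw [ofLp_toEuclideanCLM, mulVec_diagonal]

/-! ## Cut-off and diagonal symmetriser, any index type `ι` of directions -/

section CutoffGen

variable {ι : Type*}
variable {O : Set (EuclideanSpace ℝ (Fin N))} {A₀ : EuclideanSpace ℝ (Fin N) → Matrix (Fin N) (Fin N) ℝ}
  {A : ι → EuclideanSpace ℝ (Fin N) → Matrix (Fin N) (Fin N) ℝ} {χ : EuclideanSpace ℝ (Fin N) → ℝ}

/-- **Admissible cut-off data on any index type `ι` of directions** (`IsQLSymmCoeff`, with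
`Aₖ`, `k : ι`) from smooth matrix coefficients on an open state domain: `ã₀ = χ·A₀ + (1-χ)·1`,
`ãₖ = χ·Aₖ`, `P = Q = diag(ã₀ᵢᵢ^{-1/2})`, for a smooth cut-off `χ ∈ [0, 1]` compactly supported
in `𝒪`, `A₀` positive definite and diagonal and `Aₖ` symmetric on `𝒪` (Majda, p. 31: "we modify
the coefficients outside a neighbourhood `G₂` of `Ḡ₁`"; Dafermos (5.1.5)–(5.1.7)). The
construction acts on the STATE space only, so it is literally the same for every `ι`; the `𝕋³`
statement (`ι = Fin 3`) is `exists_isQLSymmCoeff_cutoff`.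
[cite: Majda1984, Ch. 2 §2.1, p. 31; Dafermos2005, §5.1 (5.1.5)–(5.1.7)] -/
theorem exists_isQLSymmCoeff_cutoff_gen (hO : IsOpen O)
    (hA0s : ∀ i j, ContDiffOn ℝ ∞ (fun v => A₀ v i j) O)
    (hAs : ∀ k i j, ContDiffOn ℝ ∞ (fun v => A k v i j) O)
    (hPD : ∀ v ∈ O, (A₀ v).PosDef) (hdiag : ∀ v ∈ O, ∀ i j, i ≠ j → A₀ v i j = 0)
    (hSy : ∀ k, ∀ v ∈ O, (A k v).IsSymm)
    (hχ : ContDiff ℝ ∞ χ) (hχc : HasCompactSupport χ) (hχO : tsupport χ ⊆ O)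
    (hχ01 : ∀ v, χ v ∈ Icc (0 : ℝ) 1) :
    ∃ (c₀ Λ₀ : ℝ) (p : EuclideanSpace ℝ (Fin N) → (EuclideanSpace ℝ (Fin N) →L[ℝ] EuclideanSpace ℝ (Fin N))),
      IsQLSymmCoeff c₀ Λ₀ (fun v => χ v • Matrix.toEuclideanCLM (n := Fin N) (𝕜 := ℝ) (A₀ v) + (1 - χ v) • (1 : EuclideanSpace ℝ (Fin N) →L[ℝ] EuclideanSpace ℝ (Fin N)))
        (fun k v => χ v • Matrix.toEuclideanCLM (n := Fin N) (𝕜 := ℝ) (A k v) + (1 - χ v) • (0 : EuclideanSpace ℝ (Fin N) →L[ℝ] EuclideanSpace ℝ (Fin N))) p p := by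
  -- smoothness of the operator fields on `O`
  have hT0 : ContDiffOn ℝ ∞ (fun v => Matrix.toEuclideanCLM (n := Fin N) (𝕜 := ℝ) (A₀ v)) O := contDiffOn_toEuclideanCLM hA0s
  have hT : ∀ k, ContDiffOn ℝ ∞ (fun v => Matrix.toEuclideanCLM (n := Fin N) (𝕜 := ℝ) (A k v)) O := fun k => contDiffOn_toEuclideanCLM (hAs k)
  have hsuppO : ∀ v, χ v ≠ 0 → v ∈ O := fun v hv => hχO (subset_tsupport _ hv)
  -- coercivity of `ã₀`
  have hpos : ∀ v ∈ O, ∀ w : EuclideanSpace ℝ (Fin N), w ≠ 0 → 0 < ⟪Matrix.toEuclideanCLM (n := Fin N) (𝕜 := ℝ) (A₀ v) w, w⟫_ℝ := fun v hv w hw =>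
    inner_toEuclideanCLM_pos (hPD v hv) hw
  obtain ⟨c₀, hc₀, hcoer⟩ := le_inner_cutoffComb_self hχc hχO hχ01 hT0.continuousOn hpos
  -- bound of `ã₀`
  obtain ⟨Λ₀, hΛ₀⟩ := exists_forall_norm_iteratedFDeriv_cutoffComb_le hO hχ hχc hχO hT0
    (1 : EuclideanSpace ℝ (Fin N) →L[ℝ] EuclideanSpace ℝ (Fin N)) 0
  -- the diagonal entries `eᵢ = χ a₀ᵢᵢ + 1 - χ ≥ c₀` and the symmetriser
  set e : Fin N → EuclideanSpace ℝ (Fin N) → ℝ := fun i v => χ v * A₀ v i i + (1 - χ v) * 1 with he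
  have hes : ∀ i, ContDiff ℝ ∞ (e i) := fun i => by
    have := contDiff_cutoffComb (V := ℝ) hO hχ hχO (hA0s i i) 1
    simpa only [smul_eq_mul] using this
  have hmat : ∀ v (w : EuclideanSpace ℝ (Fin N)) (i : Fin N),
      ((χ v • Matrix.toEuclideanCLM (n := Fin N) (𝕜 := ℝ) (A₀ v) + (1 - χ v) • (1 : EuclideanSpace ℝ (Fin N) →L[ℝ] EuclideanSpace ℝ (Fin N))) w) i = e i v * w i := by
    intro v w i
    simp only [_root_.add_apply, _root_.smul_apply, one_apply_eq_self, PiLp.add_apply, PiLp.smul_apply,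
      smul_eq_mul, toEuclideanCLM_apply_coord, he]
    by_cases hv : χ v = 0
    · simp [hv]
    · have hvO := hsuppO v hv
      rw [Finset.sum_eq_single i (fun j _ hj => by rw [hdiag v hvO i j (Ne.symm hj), zero_mul])
        (fun h => (h (Finset.mem_univ i)).elim)]
      ring
  have hec : ∀ i v, c₀ ≤ e i v := by
    intro i v
    have h1 := hcoer v (EuclideanSpace.single i (1 : ℝ))
    have h2 : ⟪(χ v • Matrix.toEuclideanCLM (n := Fin N) (𝕜 := ℝ) (A₀ v) + (1 - χ v) • (1 : EuclideanSpace ℝ (Fin N) →L[ℝ] EuclideanSpace ℝ (Fin N))) (EuclideanSpace.single i 1),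
        EuclideanSpace.single i (1 : ℝ)⟫_ℝ = e i v := by
      simp only [_root_.add_apply, _root_.smul_apply, one_apply_eq_self, inner_add_left,
        inner_smul_left, inner_toEuclideanCLM_single, EuclideanSpace.inner_single_left, he]
      simp
    rw [h2] at h1
    simpa [PiLp.norm_single] using h1
  have he0 : ∀ i v, 0 < e i v := fun i v => hc₀.trans_le (hec i v)
  set r : Fin N → EuclideanSpace ℝ (Fin N) → ℝ := fun i v => (√(e i v))⁻¹ with hr
  have hrs : ∀ i, ContDiff ℝ ∞ (r i) := fun i =>
    ((hes i).sqrt fun v => (he0 i v).ne').inv fun v => (Real.sqrt_pos.2 (he0 i v)).ne'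
  have hre : ∀ i v, r i v * (e i v * r i v) = 1 := by
    intro i v
    have hsq : r i v ^ 2 = (e i v)⁻¹ := by
      rw [hr]; simp only; rw [inv_pow, Real.sq_sqrt (he0 i v).le]
    rw [show r i v * (e i v * r i v) = e i v * r i v ^ 2 by ring, hsq, mul_inv_cancel₀ (he0 i v).ne']
  set p : EuclideanSpace ℝ (Fin N) → (EuclideanSpace ℝ (Fin N) →L[ℝ] EuclideanSpace ℝ (Fin N)) := fun v => Matrix.toEuclideanCLM (n := Fin N) (𝕜 := ℝ) (Matrix.diagonal fun i => r i v) with hp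
  have hps : ContDiff ℝ ∞ p := by
    refine contDiff_toEuclideanCLM fun i j => ?_
    by_cases hij : i = j
    · subst hij; simpa [Matrix.diagonal] using hrs i
    · simp [Matrix.diagonal, hij, contDiff_const]
  refine ⟨c₀, Λ₀, p, ?_⟩
  exact
  { smooth₀ := contDiff_cutoffComb hO hχ hχO hT0 1
    smooth := fun k => contDiff_cutoffComb hO hχ hχO (hT k) 0
    smooth_p := hps
    smooth_q := hps
    symm₀ := fun v w w' => inner_cutoffComb_symm
      (fun v hv w w' => inner_toEuclideanCLM_symm (Matrix.isHermitian_iff_isSymm.1 (hPD v (hsuppO v hv)).1) w w')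
      (fun w w' => rfl) v w w'
    symm := fun k v w w' => inner_cutoffComb_symm
      (fun v hv w w' => inner_toEuclideanCLM_symm (hSy k v (hsuppO v hv)) w w')
      (fun w w' => by
        show ⟪(0 : EuclideanSpace ℝ (Fin N)), w'⟫_ℝ = ⟪w, (0 : EuclideanSpace ℝ (Fin N))⟫_ℝ
        rw [inner_zero_left, inner_zero_right]) v w w'
    pos := hc₀
    coer := hcoer
    norm_le := fun v => by simpa using hΛ₀ v
    adj := fun v w w' => inner_toEuclideanCLM_symm (Matrix.diagonal_transpose _) w w'
    inv := fun v w => by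
      ext i
      rw [hp, toEuclideanCLM_diagonal_apply_coord, hmat, toEuclideanCLM_diagonal_apply_coord, ← mul_assoc, ← mul_assoc,
        show r i v * e i v * r i v = r i v * (e i v * r i v) by ring, hre, one_mul] }

end CutoffGen

/-! ## Cut-off and diagonal symmetriser -/

section Cutoff

variable {O : Set (EuclideanSpace ℝ (Fin N))} {A₀ : EuclideanSpace ℝ (Fin N) → Matrix (Fin N) (Fin N) ℝ}
  {A : Fin 3 → EuclideanSpace ℝ (Fin N) → Matrix (Fin N) (Fin N) ℝ} {χ : EuclideanSpace ℝ (Fin N) → ℝ}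

/-- **Admissible cut-off data** (`IsQLSymmCoeff`) from smooth matrix coefficients on an open
state domain: `ã₀ = χ·A₀ + (1-χ)·1`, `ãₖ = χ·Aₖ`, `P = Q = diag(ã₀ᵢᵢ^{-1/2})`, for a smooth
cut-off `χ ∈ [0, 1]` compactly supported in `𝒪`, `A₀` positive definite and diagonal and `Aₖ`
symmetric on `𝒪`. [cite: Majda1984, Ch. 2 §2.1, p. 31; Dafermos2005, §5.1 (5.1.5)–(5.1.7)] -/
theorem exists_isQLSymmCoeff_cutoff (hO : IsOpen O)
    (hA0s : ∀ i j, ContDiffOn ℝ ∞ (fun v => A₀ v i j) O)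
    (hAs : ∀ k i j, ContDiffOn ℝ ∞ (fun v => A k v i j) O)
    (hPD : ∀ v ∈ O, (A₀ v).PosDef) (hdiag : ∀ v ∈ O, ∀ i j, i ≠ j → A₀ v i j = 0)
    (hSy : ∀ k, ∀ v ∈ O, (A k v).IsSymm)
    (hχ : ContDiff ℝ ∞ χ) (hχc : HasCompactSupport χ) (hχO : tsupport χ ⊆ O)
    (hχ01 : ∀ v, χ v ∈ Icc (0 : ℝ) 1) :
    ∃ (c₀ Λ₀ : ℝ) (p : EuclideanSpace ℝ (Fin N) → (EuclideanSpace ℝ (Fin N) →L[ℝ] EuclideanSpace ℝ (Fin N))),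
      IsQLSymmCoeff c₀ Λ₀ (fun v => χ v • Matrix.toEuclideanCLM (n := Fin N) (𝕜 := ℝ) (A₀ v) + (1 - χ v) • (1 : EuclideanSpace ℝ (Fin N) →L[ℝ] EuclideanSpace ℝ (Fin N)))
        (fun k v => χ v • Matrix.toEuclideanCLM (n := Fin N) (𝕜 := ℝ) (A k v) + (1 - χ v) • (0 : EuclideanSpace ℝ (Fin N) →L[ℝ] EuclideanSpace ℝ (Fin N))) p p :=
  exists_isQLSymmCoeff_cutoff_gen hO hA0s hAs hPD hdiag hSy hχ hχc hχO hχ01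

end Cutoff

/-! ## The local existence theorem in matrix form on `𝕋ᵈ`, every `d` -/

/-- **Local classical solutions of quasilinear symmetric hyperbolic systems on `𝕋ᵈ` for EVERY
`d`, matrix form, diagonal `A₀`** (Majda 1984, Thm 2.1, stated in any number of space variables,
with the localisation of p. 31; Dafermos 2005, Thm 5.1.1; Kato 1975, Thm II): `𝒪 ⊆ ℝᴺ` open;
`A₀, Aₖ : 𝒪 → ℝ^{N×N}` (`k < d`) smooth, `A₀` positive definite and diagonal, `Aₖ` symmetric;
`V₀ : 𝕋ᵈ → 𝒪` smooth with compact range in `𝒪`. Then there are `T > 0` and `V` jointly `C^∞` on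
`[0, T) × 𝕋ᵈ`, with values in `𝒪`, `V(0) = V₀`, solving `A₀(V)∂ₜV + Σₖ Aₖ(V)∂ₖV = 0`
classically. Proof: word for word the `𝕋³` proof — cut-off and symmetriser
(`exists_isQLSymmCoeff_cutoff_gen`), Majda's theorem on `𝕋ᵈ` in the `C^∞` class
`IsQLSymmCoeff.exists_smooth_solution_of_wordSup` at the Sobolev margin `σ = d + 1` (hypothesis-free
through the word-form sup embedding `Torus.wordSupEmbedding_fin : d < 2σ → WordSupEmbedding (Fin d) σ`),
and the tube lemma over the compact torus `𝕋ᵈ`. The `𝕋³` statement is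
`symmHyperbolicLocalExistence_of_diagonal`; the general (non-diagonal) symmetriser is treated in
`TorusSymmHyperbolicLocalExistence`.
[cite: Majda1984, Ch. 2 §2.1, Thm 2.1, p. 31; Dafermos2005, §5.1, Thm 5.1.1; Kato1975, Thm II] -/
theorem symmHyperbolicLocalExistence_of_diagonal_dim (d N : ℕ) (O : Set (EuclideanSpace ℝ (Fin N)))
    (A₀ : EuclideanSpace ℝ (Fin N) → Matrix (Fin N) (Fin N) ℝ)
    (A : Fin d → EuclideanSpace ℝ (Fin N) → Matrix (Fin N) (Fin N) ℝ)
    (hO : IsOpen O) (hA0s : ∀ i j, ContDiffOn ℝ ∞ (fun v => A₀ v i j) O)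
    (hAs : ∀ k i j, ContDiffOn ℝ ∞ (fun v => A k v i j) O)
    (hPD : ∀ v ∈ O, (A₀ v).PosDef) (hdiag : ∀ v ∈ O, ∀ i j, i ≠ j → A₀ v i j = 0)
    (hSy : ∀ k, ∀ v ∈ O, (A k v).IsSymm)
    (V₀ : UnitAddTorus (Fin d) → EuclideanSpace ℝ (Fin N)) (hV₀ : IsSmooth V₀)
    (hK : ∃ K, IsCompact K ∧ K ⊆ O ∧ ∀ x, V₀ x ∈ K) :
    ∃ T : ℝ, 0 < T ∧ ∃ V : ℝ → UnitAddTorus (Fin d) → EuclideanSpace ℝ (Fin N),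
      IsSmoothSpaceTimeOn (Ico 0 T) V ∧ V 0 = V₀ ∧ (∀ t ∈ Ico 0 T, ∀ x, V t x ∈ O) ∧
      ∀ t ∈ Ico 0 T, ∀ x,
        (A₀ (V t x)).mulVec (WithLp.ofLp (timeDerivWithin (Ico 0 T) V t x)) +
          ∑ k, (A k (V t x)).mulVec (WithLp.ofLp (partialDeriv k (V t) x)) = 0 := by
  obtain ⟨K, hKc, hKO, hVK⟩ := hK
  obtain ⟨χ, hχ, hχc, hχO, hχ01, O', hO', hKO', hO'O, hχ1⟩ :=
    exists_contDiff_cutoff_eq_one_nhds hO hKc hKO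
  obtain ⟨c₀, Λ₀, p, hql⟩ := exists_isQLSymmCoeff_cutoff_gen hO hA0s hAs hPD hdiag hSy hχ hχc hχO hχ01
  -- Majda's theorem on `𝕋ᵈ` in the `C^∞` class at the margin `σ = d + 1` (`d < 2σ`)
  obtain ⟨T, hT, V, hVs, hV0, hEq⟩ :=
    hql.exists_smooth_solution_of_wordSup (wordSupEmbedding_fin (σ := d + 1) (by omega)) hV₀
  -- tube: the values stay in `O'` for small times
  have hcont : ContinuousOn (stLift V) (Ioo (-T) T ×ˢ univ) := hVs.continuousOn
  set n : Set (ℝ × EuclideanSpace ℝ (Fin d)) := (Ioo (-T) T ×ˢ univ) ∩ stLift V ⁻¹' O' with hn_def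
  have hn : IsOpen n := hcont.isOpen_inter_preimage (isOpen_Ioo.prod isOpen_univ) hO'
  have hsub : ({(0 : ℝ)} : Set ℝ) ×ˢ ((WithLp.toLp 2) '' (Set.pi univ fun _ : Fin d => Icc (0 : ℝ) 1)) ⊆ n := by
    rintro ⟨t, y⟩ ⟨ht, -⟩
    rw [mem_singleton_iff] at ht
    subst ht
    refine ⟨⟨⟨by linarith, hT⟩, mem_univ _⟩, ?_⟩
    show V 0 (proj y) ∈ O'
    rw [hV0]
    exact hKO' (hVK _)
  obtain ⟨u, w, hu, -, h0u, hcw, huw⟩ :=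
    generalized_tube_lemma isCompact_singleton isCompact_toLp_image_pi_Icc hn hsub
  obtain ⟨δ, hδ, hδu⟩ := Metric.isOpen_iff.1 hu 0 (h0u rfl)
  have hsubI : Ico 0 (min δ T) ⊆ Ioo (-T) T := fun t ht =>
    ⟨by linarith [ht.1], ht.2.trans_le (min_le_right _ _)⟩
  have hinO' : ∀ t ∈ Ico 0 (min δ T), ∀ x, V t x ∈ O' := by
    intro t ht x
    have htu : t ∈ u := hδu (by
      rw [Metric.mem_ball, dist_zero_right, Real.norm_eq_abs, abs_of_nonneg ht.1]
      exact ht.2.trans_le (min_le_left _ _))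
    have h := (huw (mk_mem_prod htu (hcw (repr_mem_toLp_image_pi_Icc x)))).2
    simpa [stLift, proj_repr] using h
  refine ⟨min δ T, lt_min hδ hT, V, hVs.mono hsubI, hV0,
    fun t ht x => hO'O (hinO' t ht x), fun t ht x => ?_⟩
  have htI := hsubI ht
  have h1 := hEq t htI x
  have hχv : χ (V t x) = 1 := hχ1 _ (hinO' t ht x)
  -- `timeDerivWithin = timeDeriv` at interior-differentiable points
  have hsl := (hVs.hasDerivWithinAt_slice htI x).hasDerivAt (isOpen_Ioo.mem_nhds htI)
  have hd : timeDerivWithin (Ico 0 (min δ T)) V t x = timeDeriv V t x := by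
    show derivWithin (fun τ => V τ x) (Ico 0 (min δ T)) t = deriv (fun τ => V τ x) t
    rw [hsl.hasDerivWithinAt.derivWithin (uniqueDiffOn_Ico 0 (min δ T) t ht), hsl.deriv]
  rw [hd]
  simp only [hχv, one_smul, sub_self] at h1
  have h2 := congrArg WithLp.ofLp h1
  simpa [WithLp.ofLp_add, WithLp.ofLp_sum, ofLp_toEuclideanCLM] using h2

/-! ## The local existence theorem in matrix form -/

/-- **Local classical solutions of quasilinear symmetric hyperbolic systems on `𝕋³`, matrix
form, diagonal `A₀`** (Dafermos, Thm 5.1.1 (smooth periodic data); Majda, Thm 2.1 with the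
localisation of p. 31; Kato 1975): `𝒪 ⊆ ℝᴺ` open; `A₀, Aₖ : 𝒪 → ℝ^{N×N}` smooth, `A₀`
positive definite and diagonal, `Aₖ` symmetric; `V₀ : 𝕋³ → 𝒪` smooth with compact range in
`𝒪`. Then there are `T > 0` and `V` jointly `C^∞` on `[0, T) × 𝕋³`, with values in `𝒪`,
`V(0) = V₀`, solving `A₀(V)∂ₜV + Σₖ Aₖ(V)∂ₖV = 0` classically. Proof: cut the coefficients
off outside a compact part of `𝒪` and symmetrise (`exists_isQLSymmCoeff_cutoff`), solve by
`IsQLSymmCoeff.exists_smooth_solution`, and restrict to the times at which the values stay in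
the region where the cut-off is `1` (tube lemma over the compact torus).
[cite: Dafermos2005, §5.1, Thm 5.1.1; Majda1984, Ch. 2 §2.1, Thm 2.1, p. 31] -/
theorem symmHyperbolicLocalExistence_of_diagonal (N : ℕ) (O : Set (EuclideanSpace ℝ (Fin N)))
    (A₀ : EuclideanSpace ℝ (Fin N) → Matrix (Fin N) (Fin N) ℝ)
    (A : Fin 3 → EuclideanSpace ℝ (Fin N) → Matrix (Fin N) (Fin N) ℝ)
    (hO : IsOpen O) (hA0s : ∀ i j, ContDiffOn ℝ ∞ (fun v => A₀ v i j) O)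
    (hAs : ∀ k i j, ContDiffOn ℝ ∞ (fun v => A k v i j) O)
    (hPD : ∀ v ∈ O, (A₀ v).PosDef) (hdiag : ∀ v ∈ O, ∀ i j, i ≠ j → A₀ v i j = 0)
    (hSy : ∀ k, ∀ v ∈ O, (A k v).IsSymm)
    (V₀ : UnitAddTorus (Fin 3) → EuclideanSpace ℝ (Fin N)) (hV₀ : IsSmooth V₀)
    (hK : ∃ K, IsCompact K ∧ K ⊆ O ∧ ∀ x, V₀ x ∈ K) :
    ∃ T : ℝ, 0 < T ∧ ∃ V : ℝ → UnitAddTorus (Fin 3) → EuclideanSpace ℝ (Fin N),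
      IsSmoothSpaceTimeOn (Ico 0 T) V ∧ V 0 = V₀ ∧ (∀ t ∈ Ico 0 T, ∀ x, V t x ∈ O) ∧
      ∀ t ∈ Ico 0 T, ∀ x,
        (A₀ (V t x)).mulVec (WithLp.ofLp (timeDerivWithin (Ico 0 T) V t x)) +
          ∑ k, (A k (V t x)).mulVec (WithLp.ofLp (partialDeriv k (V t) x)) = 0 :=
  symmHyperbolicLocalExistence_of_diagonal_dim 3 N O A₀ A hO hA0s hAs hPD hdiag hSy V₀ hV₀ hK

end Literature.Analysis.PDE

end
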